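import Summits.CriticalPhenomena.PercolationContinuityZ3.Theorems.PercNearOneGluingNoHeavyLowerTailSunflowerMultiPetalKempeMarkedInduce
import HarnessLib
import HarnessLib.Audit

/-!
# `NoHeavyLowerTail` (crux stmt-CriticalPhenomena-4575): EVERY PINNED ONE-POINT CLASS IS NONNEGATIVE — the discharge of the tree's obligation `PinnedMZ`
# (kernel-checked)

Support file (seat `prim-l12-p2` gen 49; `--supports stmt-CriticalPhenomena-4575`; continuation of `…KempeMarkedInduce` (p610461), `…KempeMarkedClasses` (p608443:
`sum_class_nonneg`, `kerAbs_of_mono`, `QcolM_eq_pow_mul_mono`), `…KempeMarkedLemmaB` (p609343), and of `…KempePinned` (p414773: `PinnedMZ`, `pinnedClass`, `kerMZ`)).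
No `sorry`; nothing is asserted about the crux.

THEOREM R proved `Σ_classes ≥ 0` with the three MONOCHROMATIC boundary classes taken together; here each class is shown nonnegative on its own:
* `sum_monoClass_eq` — the three monochromatic classes have EQUAL sums (a colour permutation, then re-pinning the free vertex `x`), hence each is a third of
  `(Q(C⁺) + Q(C))/3^{|N(x)|} ≥ 0` (`sum_monoClass_nonneg`); the isolated case is `(2/3)·Q(K − x) ≥ 0` (`sum_class_nonneg_of_nbrs_empty`);
* `sum_pinnedClassM_nonneg` — every boundary class of an unmarked vertex of a marked multigraph is nonnegative (non-constant classes: `sum_class_nonneg`, p608443,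
  with `TfunM_nonneg`);
* the bridge to the simple-graph language (`profM_ofSimple_extCol`, `kerMZ_eq_kerAbs_ofSimple`, `sum_pinnedClass_eq`) and **`pinnedMZ_holds : PinnedMZ`**
  (the connectivity hypotheses of p414773's obligation are not needed).
-/

namespace Summit.CriticalPhenomena.PercolationContinuityZ3.Theorems.SunflowerPartition.Kempe

open Finset

namespace MGraph

variable {V : Type*} [Fintype V] [LinearOrder V] (K : MGraph V)

section Classes

variable (x : V)

/-- Re-pinning a free vertex: inside a filter and a summand that ignore `x`, the pinned colour of `x` can be changed. [this work] -/
theorem sum_filter_pin_eq (P : (V → Fin 3) → Prop) [DecidablePred P] (hP : ∀ σ c, P (Function.update σ x c) ↔ P σ)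
    (G : (V → Fin 3) → ℤ) (hG : ∀ σ c, G (Function.update σ x c) = G σ) (c c' : Fin 3) :
    ∑ σ ∈ univ.filter (fun σ => P σ ∧ σ x = c), G σ = ∑ σ ∈ univ.filter (fun σ => P σ ∧ σ x = c'), G σ := by
  have h1 := sum_filter_eq_three_mul x P hP G hG (fun _ => c) (fun _ _ => rfl)
  have h2 := sum_filter_eq_three_mul x P hP G hG (fun _ => c') (fun _ _ => rfl)
  linarith

/-- **The three monochromatic boundary classes have equal sums** (for a summand invariant under colour permutations and blind to the free vertex `x`). [this work] -/
theorem sum_monoClass_eq (G : (V → Fin 3) → ℤ) (hperm : ∀ (θ θ' : Fin 3 → Fin 3), (∀ d, θ' (θ d) = d) → (∀ d, θ (θ' d) = d) → ∀ σ, G (fun w => θ (σ w)) = G σ)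
    (hG : ∀ σ c, G (Function.update σ x c) = G σ) (a b : Fin 3) :
    ∑ ρ ∈ univ.filter (fun ρ : V → Fin 3 => ρ x = 0 ∧ ∀ w ∈ K.nbrs x, ρ w = a), G ρ
      = ∑ ρ ∈ univ.filter (fun ρ : V → Fin 3 => ρ x = 0 ∧ ∀ w ∈ K.nbrs x, ρ w = b), G ρ := by
  obtain ⟨θ, θ', hθ, h1, h2⟩ := exists_colourPerm_one a b
  -- recolour by θ: colour a on N(x) becomes b, the colour of x becomes θ 0
  have step1 : ∑ ρ ∈ univ.filter (fun ρ : V → Fin 3 => ρ x = 0 ∧ ∀ w ∈ K.nbrs x, ρ w = a), G ρ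
      = ∑ ρ ∈ univ.filter (fun ρ : V → Fin 3 => (∀ w ∈ K.nbrs x, ρ w = b) ∧ ρ x = θ 0), G ρ := by
    refine sum_nbij' (fun ρ w => θ (ρ w)) (fun ρ w => θ' (ρ w)) ?_ ?_ ?_ ?_ ?_
    · intro ρ hρ
      obtain ⟨hx, hN⟩ := (mem_filter.1 hρ).2
      simp only [mem_filter, mem_univ, true_and]
      exact ⟨fun w hw => by rw [hN w hw, hθ], by rw [hx]⟩
    · intro ρ hρ
      obtain ⟨hN, hx⟩ := (mem_filter.1 hρ).2
      simp only [mem_filter, mem_univ, true_and]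
      exact ⟨by rw [hx, h1], fun w hw => by rw [hN w hw, ← hθ, h1]⟩
    · intro ρ _; funext w; exact h1 _
    · intro ρ _; funext w; exact h2 _
    · intro ρ _; exact (hperm θ θ' h1 h2 ρ).symm
  -- the filter `ρ ≡ b on N(x)` ignores the colour of x (x ∉ N(x)), so the free vertex x can be re-pinned to 0
  have hPx : ∀ (σ : V → Fin 3) (c : Fin 3), (∀ w ∈ K.nbrs x, Function.update σ x c w = b) ↔ (∀ w ∈ K.nbrs x, σ w = b) := by
    intro σ c
    constructor
    · intro h w hw
      have := h w hw
      rwa [Function.update_of_ne (K.ne_of_mem_nbrs x hw)] at this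
    · intro h w hw
      rw [Function.update_of_ne (K.ne_of_mem_nbrs x hw)]
      exact h w hw
  rw [step1, sum_filter_pin_eq x (fun ρ => ∀ w ∈ K.nbrs x, ρ w = b) hPx G hG (θ 0) 0]
  refine sum_congr ?_ fun _ _ => rfl
  ext ρ
  simp only [mem_filter, mem_univ, true_and]
  exact and_comm

/-- **A monochromatic boundary class is nonnegative** on its own: it is a third of `(Q(C⁺) + Q(C))/3^{|N(x)|}`. [this work] -/
theorem sum_monoClass_nonneg (hmark : K.mark x = 0) {w₀ : V} (hw₀ : w₀ ∈ K.nbrs x) (a : Fin 3) :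
    0 ≤ ∑ ρ ∈ univ.filter (fun ρ : V → Fin 3 => ρ x = 0 ∧ ∀ w ∈ K.nbrs x, ρ w = a), kerAbs ((K.isolate x).ctypeM ρ) (K.profM x ρ) := by
  have hw₀x : w₀ ≠ x := K.ne_of_mem_nbrs x hw₀
  set C := K.peelContract x ((K.nbrs x).erase w₀) w₀ with hC
  set C' := C.addMark w₀ (K.mdeg x) with hC'
  set G : (V → Fin 3) → ℤ := fun ρ => lbW (C'.ctypeM ρ) + lbW (C.ctypeM ρ) with hGdef
  -- the summand on a monochromatic class
  have hsum : ∀ b : Fin 3, ∑ ρ ∈ univ.filter (fun ρ : V → Fin 3 => ρ x = 0 ∧ ∀ w ∈ K.nbrs x, ρ w = b), kerAbs ((K.isolate x).ctypeM ρ) (K.profM x ρ)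
      = ∑ ρ ∈ univ.filter (fun ρ : V → Fin 3 => ρ x = 0 ∧ ∀ w ∈ K.nbrs x, ρ w = b), G ρ := by
    intro b
    refine sum_congr rfl fun ρ hρ => ?_
    obtain ⟨-, hN⟩ := (mem_filter.1 hρ).2
    exact K.kerAbs_of_mono x hmark hw₀ ρ (fun w hw => by rw [hN w hw, hN w₀ hw₀])
  -- freeness of x and N(x) ∖ w₀ in C and C'
  have hfreeC : ∀ z ∈ insert x ((K.nbrs x).erase w₀), C.IsFree z := by
    intro z hz
    rcases mem_insert.1 hz with e | e
    · rw [e]; exact K.isFree_peelContract_self x w₀ _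
    · exact K.isFree_peelContract_of_mem x w₀ _ e
  have hfreeC' : ∀ z ∈ insert x ((K.nbrs x).erase w₀), C'.IsFree z := by
    intro z hz
    have hzw : z ≠ w₀ := by
      rcases mem_insert.1 hz with e | e
      · rw [e]; exact hw₀x.symm
      · exact (mem_erase.1 e).1
    exact isFree_addMark _ w₀ _ (hfreeC z hz) hzw
  have hxC : C.IsFree x := hfreeC x (mem_insert_self x _)
  have hxC' : C'.IsFree x := hfreeC' x (mem_insert_self x _)
  -- G is blind to x and symmetric under colour permutations
  have hGx : ∀ σ c, G (Function.update σ x c) = G σ := fun σ c => by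
    simp only [hGdef, C.ctypeM_update_of_isFree hxC, C'.ctypeM_update_of_isFree hxC']
  have hGperm : ∀ (θ θ' : Fin 3 → Fin 3), (∀ d, θ' (θ d) = d) → (∀ d, θ (θ' d) = d) → ∀ σ, G (fun w => θ (σ w)) = G σ := by
    intro θ θ' h1 h2 σ
    have hinj : ∀ p q, θ' p = θ' q → p = q := fun p q h => by rw [← h2 p, ← h2 q, h]
    simp only [hGdef, C.ctypeM_comp_perm θ θ' h2 h1 σ, C'.ctypeM_comp_perm θ θ' h2 h1 σ, lbW_permCT θ' hinj]
  -- the total over the monochromatic colourings is (Q(C') + Q(C)) / 3^{|Z|}, and it is three times the class of colour a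
  have e1 := K.QcolM_eq_pow_mul_mono x C hw₀ hfreeC
  have e2 := K.QcolM_eq_pow_mul_mono x C' hw₀ hfreeC'
  have htot : ∑ ρ ∈ univ.filter (fun ρ : V → Fin 3 => ρ x = 0 ∧ ∀ w ∈ K.nbrs x, ρ w = ρ w₀), G ρ
      = 3 * ∑ ρ ∈ univ.filter (fun ρ : V → Fin 3 => ρ x = 0 ∧ ∀ w ∈ K.nbrs x, ρ w = a), G ρ := by
    rw [← sum_fiberwise (univ.filter fun ρ : V → Fin 3 => ρ x = 0 ∧ ∀ w ∈ K.nbrs x, ρ w = ρ w₀) (fun ρ => ρ w₀) G]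
    have hfib : ∀ b : Fin 3, ((univ.filter fun ρ : V → Fin 3 => ρ x = 0 ∧ ∀ w ∈ K.nbrs x, ρ w = ρ w₀).filter fun ρ => ρ w₀ = b)
        = univ.filter (fun ρ : V → Fin 3 => ρ x = 0 ∧ ∀ w ∈ K.nbrs x, ρ w = b) := by
      intro b
      ext ρ
      simp only [mem_filter, mem_univ, true_and]
      constructor
      · rintro ⟨⟨hx, hN⟩, hb⟩
        exact ⟨hx, fun w hw => by rw [hN w hw, hb]⟩
      · rintro ⟨hx, hN⟩
        exact ⟨⟨hx, fun w hw => by rw [hN w hw, hN w₀ hw₀]⟩, hN w₀ hw₀⟩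
    rw [Fin.sum_univ_three, hfib 0, hfib 1, hfib 2, K.sum_monoClass_eq x G hGperm hGx 0 a, K.sum_monoClass_eq x G hGperm hGx 1 a,
      K.sum_monoClass_eq x G hGperm hGx 2 a]
    ring
  have hsplit : ∑ ρ ∈ univ.filter (fun ρ : V → Fin 3 => ρ x = 0 ∧ ∀ w ∈ K.nbrs x, ρ w = ρ w₀), G ρ
      = ∑ ρ ∈ univ.filter (fun ρ : V → Fin 3 => ρ x = 0 ∧ ∀ w ∈ K.nbrs x, ρ w = ρ w₀), lbW (C'.ctypeM ρ)
        + ∑ ρ ∈ univ.filter (fun ρ : V → Fin 3 => ρ x = 0 ∧ ∀ w ∈ K.nbrs x, ρ w = ρ w₀), lbW (C.ctypeM ρ) := by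
    rw [← sum_add_distrib]
  have hQC : 0 ≤ C.QcolM := C.QcolM_nonneg
  have hQC' : 0 ≤ C'.QcolM := C'.QcolM_nonneg
  have h3 : (0 : ℤ) < 3 ^ (insert x ((K.nbrs x).erase w₀)).card := by positivity
  rw [e1] at hQC
  rw [e2] at hQC'
  have hA := (mul_nonneg_iff_of_pos_left h3).1 hQC
  have hB := (mul_nonneg_iff_of_pos_left h3).1 hQC'
  rw [hsum a]
  linarith

/-- The class of an isolated unmarked vertex is `(2/3)·Q(K − x) ≥ 0`. [this work] -/
theorem sum_class_nonneg_of_nbrs_empty (hmark : K.mark x = 0) (hN : K.nbrs x = ∅) (κ : V → Fin 3) :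
    0 ≤ ∑ ρ ∈ univ.filter (fun ρ : V → Fin 3 => ρ x = 0 ∧ ∀ w ∈ K.nbrs x, ρ w = κ w), kerAbs ((K.isolate x).ctypeM ρ) (K.profM x ρ) := by
  have hprof : ∀ ρ, K.profM x ρ = (0, 0, 0) := by
    intro ρ
    have hl : ∀ c, K.linkM x ρ c = 0 := fun c => by
      unfold linkM
      refine sum_eq_zero fun w _ => ?_
      have : K.mul x w = 0 := K.mul_eq_zero_of_not_mem_nbrs x (by rw [hN]; exact notMem_empty w)
      simp [this]
    unfold profM
    rw [hl 0, hl 1, hl 2, hmark]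
    rfl
  have hfil : (univ.filter fun ρ : V → Fin 3 => ρ x = 0 ∧ ∀ w ∈ K.nbrs x, ρ w = κ w) = univ.filter (fun ρ : V → Fin 3 => ρ x = 0) := by
    ext ρ
    simp [hN]
  rw [hfil, sum_congr rfl (fun ρ _ => by rw [hprof ρ, kerAbs_zero_profile]), ← mul_sum]
  have h := (K.isolate x).QcolM_eq_three_mul_pin x
  have h0 := (K.isolate x).QcolM_nonneg
  linarith

/-- **EVERY PINNED CLASS OF AN UNMARKED VERTEX IS NONNEGATIVE** (marked-multigraph form of `PinnedMZ`, no connectivity needed). [this work] -/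
theorem sum_pinnedClassM_nonneg (hmark : K.mark x = 0) (κ : V → Fin 3) :
    0 ≤ ∑ ρ ∈ univ.filter (fun ρ : V → Fin 3 => ρ x = 0 ∧ ∀ w ∈ K.nbrs x, ρ w = κ w), kerAbs ((K.isolate x).ctypeM ρ) (K.profM x ρ) := by
  by_cases hN : K.nbrs x = ∅
  · exact K.sum_class_nonneg_of_nbrs_empty x hmark hN κ
  obtain ⟨w₀, hw₀⟩ := nonempty_of_ne_empty hN
  by_cases hmono : ∀ w ∈ K.nbrs x, κ w = κ w₀
  · have hfil : (univ.filter fun ρ : V → Fin 3 => ρ x = 0 ∧ ∀ w ∈ K.nbrs x, ρ w = κ w)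
        = univ.filter (fun ρ : V → Fin 3 => ρ x = 0 ∧ ∀ w ∈ K.nbrs x, ρ w = κ w₀) := by
      refine filter_congr fun ρ _ => ?_
      constructor
      · rintro ⟨hx, h⟩; exact ⟨hx, fun w hw => by rw [h w hw, hmono w hw]⟩
      · rintro ⟨hx, h⟩; exact ⟨hx, fun w hw => by rw [h w hw, hmono w hw]⟩
    rw [hfil]
    exact K.sum_monoClass_nonneg x hmark hw₀ (κ w₀)
  · exact K.sum_class_nonneg x hmark hw₀ (fun p α _ _ _ => TfunM_nonneg _ α p) κ hmono

end Classes

/-! ## Bridge to the simple-graph obligation `PinnedMZ` -/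

section Bridge

variable (G : SimpleGraph V) [DecidableRel G.Adj] (x : V)

omit [LinearOrder V] in
/-- Neighbourhood of `ofSimple G`. [this work] -/
theorem mem_nbrs_ofSimple {w : V} : w ∈ (ofSimple G).nbrs x ↔ G.Adj x w := by
  rw [mem_nbrs]
  unfold ofSimple
  simp

omit [LinearOrder V] in
/-- The profile of `x` in `ofSimple G` at `(τ, x ↦ c)` is the neighbourhood profile `prof3 G x τ`. [this work] -/
theorem profM_ofSimple_extCol (τ : (({x}ᶜ : Set V)) → Fin 3) (c : Fin 3) : (ofSimple G).profM x (extCol x τ c) = prof3 G x τ := by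
  have hmark : (ofSimple G).mark x = 0 := rfl
  have hl : ∀ d : Fin 3, (ofSimple G).linkM x (extCol x τ c) d = prof G x τ d := by
    intro d
    unfold linkM prof
    have hterm : ∀ w : V, (if extCol x τ c w = d then (ofSimple G).mul x w else 0) = if (G.Adj x w ∧ extCol x τ c w = d) then 1 else 0 := by
      intro w
      unfold ofSimple
      by_cases h1 : extCol x τ c w = d <;> by_cases h2 : G.Adj x w <;> simp [h1, h2]
    rw [sum_congr rfl (fun w _ => hterm w), sum_boole, Nat.cast_id]
    refine card_bij (fun w hw => ⟨w, Set.mem_compl_singleton_iff.mpr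
        (G.ne_of_adj (by simp only [mem_filter, mem_univ, true_and] at hw; exact hw.1)).symm⟩) ?_ ?_ ?_
    · intro w hw
      simp only [mem_filter, mem_univ, true_and] at hw ⊢
      refine ⟨hw.1, ?_⟩
      have h2 := hw.2
      rw [extCol_of_ne x τ c (G.ne_of_adj hw.1).symm] at h2
      exact h2
    · intro w₁ _ w₂ _ h
      exact congrArg Subtype.val h
    · intro w hw
      simp only [mem_filter, mem_univ, true_and] at hw
      refine ⟨w.1, ?_, rfl⟩
      simp only [mem_filter, mem_univ, true_and]
      exact ⟨hw.1, by rw [extCol_val]; exact hw.2⟩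
  unfold profM prof3
  rw [hl 0, hl 1, hl 2, hmark, add_zero, add_zero, add_zero]

/-- The one-point kernel of the simple graph is the marked-multigraph kernel of `ofSimple G`. [this work] -/
theorem kerMZ_eq_kerAbs_ofSimple (τ : (({x}ᶜ : Set V)) → Fin 3) :
    kerMZ G x τ = kerAbs (((ofSimple G).isolate x).ctypeM (extCol x τ 0)) ((ofSimple G).profM x (extCol x τ 0)) := by
  rw [kerMZ_eq_kerAbs, profM_ofSimple_extCol]
  congr 1
  convert (ctypeM_isolate_ofSimple_extCol G x τ 0).symm using 2

/-- The pinned class sum of the simple graph is the boundary-class sum of `ofSimple G`. [this work] -/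
theorem sum_pinnedClass_eq (κ : V → Fin 3) :
    ∑ τ ∈ pinnedClass G x κ, kerMZ G x τ
      = ∑ ρ ∈ univ.filter (fun ρ : V → Fin 3 => ρ x = 0 ∧ ∀ w ∈ (ofSimple G).nbrs x, ρ w = κ w),
          kerAbs (((ofSimple G).isolate x).ctypeM ρ) ((ofSimple G).profM x ρ) := by
  refine sum_nbij' (fun τ => extCol x τ 0) (fun ρ => ρ ∘ Subtype.val) (fun τ hτ => ?_) (fun ρ hρ => ?_)
    (fun τ _ => extCol_comp_val x τ 0) (fun ρ hρ => ?_) (fun τ _ => kerMZ_eq_kerAbs_ofSimple G x τ)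
  · have hτ' : ∀ w : ({x}ᶜ : Set V), G.Adj x w.1 → τ w = κ w.1 := by
      simpa only [pinnedClass, mem_filter, mem_univ, true_and] using hτ
    simp only [mem_filter, mem_univ, true_and]
    refine ⟨extCol_self x τ 0, fun w hw => ?_⟩
    have hadj : G.Adj x w := (mem_nbrs_ofSimple G x).1 hw
    rw [extCol_of_ne x τ 0 (G.ne_of_adj hadj).symm]
    exact hτ' ⟨w, Set.mem_compl_singleton_iff.mpr (G.ne_of_adj hadj).symm⟩ hadj
  · obtain ⟨-, hN⟩ := (mem_filter.1 hρ).2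
    simp only [pinnedClass, mem_filter, mem_univ, true_and]
    intro w hw
    exact hN w.1 ((mem_nbrs_ofSimple G x).2 hw)
  · have hx : ρ x = 0 := ((mem_filter.1 hρ).2).1
    have := extCol_restrict x ρ
    rw [hx] at this
    exact this

/-- **Every pinned class of every finite simple graph is nonnegative** (linear-order form). [this work] -/
theorem sum_pinnedClass_nonneg (κ : V → Fin 3) : 0 ≤ ∑ τ ∈ pinnedClass G x κ, kerMZ G x τ := by
  rw [sum_pinnedClass_eq G x κ]
  exact (ofSimple G).sum_pinnedClassM_nonneg x rfl κ

end Bridge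

end MGraph

/-- **`PinnedMZ` HOLDS** (the pinned one-point obligation of p414773 is a theorem; the connectivity hypotheses are not needed). [this work] -/
theorem pinnedMZ_holds : PinnedMZ := by
  intro W _ G x _ _ κ
  classical
  letI : LinearOrder W := LinearOrder.lift' (Fintype.equivFin W) (Fintype.equivFin W).injective
  exact MGraph.sum_pinnedClass_nonneg G x κ

end Summit.CriticalPhenomena.PercolationContinuityZ3.Theorems.SunflowerPartition.Kempe
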